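import Literature.AlgebraicGeometry.Resolution.SmoothUniformizationProofs
import HarnessLib

/-!
# Crux `Steer` (stmt-ResolutionOfSingularities-16345), chain W4.1 — K-β7-HAT, W1 `BranchTransfer` FILE 2 `OrderTwoDescent`:
# order two descends along a flat local homomorphism with regular closed fibre

OURS (campaign `res-hironaka`, rung L, slot W4.1; hand res-L0-w44-stub-3 g14 from the ★L-G4 W4.4 reserve, res-L0-w41-plan-1
RULING 252 (b) «FILE 2 → pool, first refusal res-L0-w44-stub-3»).  PIECE (G2) of res-L0-w41-idea-3's W1 route
(`L/res-L0-w41-idea-3/k7w1/W1-PLAN.md` §1 (G2), §2 row 2; signature file `K7HatW1_signatures.lean` b44118b3d9553ffe §2,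
`mem_sq_of_algebraMap_mem_sq` — stated here with EXACTLY that signature, namespace `…K7HatOrderTwoDescent` instead of
`…K7HatW1Sig`, so FILE 6 `…K7HatBranchTransfer` imports it unchanged).

`mem_sq_of_algebraMap_mem_sq`: for a flat local homomorphism `(R, 𝔪) → (S, 𝔫)` of Noetherian local rings whose closed fibre
`S/𝔪S` is a regular local ring, `algebraMap R S a ∈ 𝔫²` forces `a ∈ 𝔪²` (i.e. `𝔫² ∩ R = 𝔪²`).  PROOF (W1-PLAN (G2)): `a` is a
non-unit, so `a = ∑ cᵢ xᵢ` on a minimal basis `x` of `𝔪`; its image lies in `𝔪S ∩ 𝔫² ⊆ 𝔪S·𝔫`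
(`Literature…map_maximalIdeal_inf_sq_le_mul`, Matsumura 23.7 key step), so every `algebraMap R S cᵢ ∈ 𝔫` by the flatness input
`Literature…mem_maximalIdeal_of_sum_mul_mem_map_mul`; units map to units, hence `cᵢ ∈ 𝔪` and `a ∈ 𝔪·𝔪 = 𝔪²`.
Def-free, fact-free, kernel lane; `--supports stmt-ResolutionOfSingularities-16345 --as helper`.  Candidates of this cell, not
statements of the manuscript under review [claim: Hironaka2017, status: under-review]; AI work, weaker than expert review.
-/

noncomputable section

-- single-problem summit: the doubled namespace component `ResolutionOfSingularities` is forced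
set_option linter.dupNamespace false

open IsLocalRing

namespace Summit.ResolutionOfSingularities.ResolutionOfSingularities.Theorems.SwitchingDichotomy.K7HatOrderTwoDescent

open Literature.AlgebraicGeometry.Resolution

universe u

/-- **(G2) ORDER-TWO DESCENT.**  Flat local homomorphism of Noetherian local rings `(R, 𝔪) → (S, 𝔫)` with regular closed
fibre `S/𝔪S`: `a ∈ R`, `algebraMap R S a ∈ 𝔫²` ⇒ `a ∈ 𝔪²` (tree `map_maximalIdeal_inf_sq_le_mul` : `𝔪S ∩ 𝔫² ≤ 𝔪S·𝔫`, then
`mem_maximalIdeal_of_sum_mul_mem_map_mul` on a minimal basis of `𝔪`).  Signature = res-L0-w41-idea-3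
`K7HatW1_signatures.lean` b44118b3d9553ffe §2 verbatim. [folklore: Matsumura, *Commutative Ring Theory*, proof of Thm 23.7] -/
theorem mem_sq_of_algebraMap_mem_sq {R S : Type u} [CommRing R] [CommRing S] [IsLocalRing R] [IsNoetherianRing R]
    [IsLocalRing S] [IsNoetherianRing S] [Algebra R S] [IsLocalHom (algebraMap R S)] [Module.Flat R S]
    (hfib : IsRegularLocalRing (S ⧸ (maximalIdeal R).map (algebraMap R S))) {a : R}
    (ha : algebraMap R S a ∈ maximalIdeal S ^ 2) : a ∈ maximalIdeal R ^ 2 := by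
  classical
  haveI := hfib
  -- `a` is a non-unit (units map to units)
  have ha1 : algebraMap R S a ∈ maximalIdeal S := Ideal.pow_le_self two_ne_zero ha
  have ha𝔪 : a ∈ maximalIdeal R := by
    rw [IsLocalRing.mem_maximalIdeal, mem_nonunits_iff] at ha1 ⊢
    exact fun hu => ha1 (hu.map _)
  -- write `a` on a minimal basis `x` of `𝔪`
  obtain ⟨x, hx⟩ := exists_minimalBasis_maximalIdeal (R := R)
  have hax : a ∈ Ideal.span (Set.range x) := by
    rw [hx]
    exact ha𝔪
  obtain ⟨c, hc⟩ := Ideal.mem_span_range_iff_exists_fun.mp hax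
  -- the image lies in `𝔪S ∩ 𝔫² ⊆ 𝔪S·𝔫`
  have hsum : (∑ i, algebraMap R S (c i) * algebraMap R S (x i)) = algebraMap R S a := by
    rw [← hc, map_sum]
    exact Finset.sum_congr rfl fun i _ => (map_mul _ _ _).symm
  have hmem : (∑ i, algebraMap R S (c i) * algebraMap R S (x i)) ∈
      (maximalIdeal R).map (algebraMap R S) * maximalIdeal S := by
    rw [hsum]
    exact map_maximalIdeal_inf_sq_le_mul ⟨Ideal.mem_map_of_mem _ ha𝔪, ha⟩
  -- flatness: every coefficient maps into `𝔫`, hence lies in `𝔪`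
  have hc𝔪 : ∀ i, c i ∈ maximalIdeal R := fun i => by
    have hi : algebraMap R S (c i) ∈ maximalIdeal S :=
      mem_maximalIdeal_of_sum_mul_mem_map_mul rfl x hx (fun i => algebraMap R S (c i)) hmem i
    rw [IsLocalRing.mem_maximalIdeal, mem_nonunits_iff] at hi ⊢
    exact fun hu => hi (hu.map _)
  -- so `a = ∑ cᵢ xᵢ ∈ 𝔪·𝔪 = 𝔪²`
  have hx𝔪 : ∀ i, x i ∈ maximalIdeal R := fun i => hx ▸ Ideal.subset_span ⟨i, rfl⟩
  rw [← hc, pow_two]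
  exact Ideal.sum_mem _ fun i _ => Ideal.mul_mem_mul (hc𝔪 i) (hx𝔪 i)

end Summit.ResolutionOfSingularities.ResolutionOfSingularities.Theorems.SwitchingDichotomy.K7HatOrderTwoDescent

end
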